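import Summits.Ventures.HSemireg.TwoLevelObstructionBridge
import HarnessLib

/-!
# Venture HSemireg — FRAME REDUCTION: a Künneth–Leray frame from (i) a line-bundle realisation, (ii) the CLASSICAL
# Künneth ∕ Leray ∕ index identifications in hypothesis form, and (iii) ONE new hypothesis, the `ob`-dictionary (B4)

HONEST FRAMING. Lean side of the computation cell `pub-hsemireg` (S4-PUSH, H2 door PAD-4; seat s4-prove-1 g29,
2026-08-28; TIER-3, object (c7) of director-hodge R14.7, priced on the cell bus). `TwoLevelObstructionBridge.lean`
((c6)) types the model→sheaf bridge of row 716 as «`KunnethLerayFrame` ⇒ ((∀ κ, ob_κ(E) = 0) ⇒ `D.H2`)» with ONE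
hypothesis structure. This file splits that structure so that a reader sees which of its fields are CLASSICAL and
which one is NEW:

* (i) `LineBundleRealisation X D` — GEOMETRY ONLY: the constituents `N_i, P_j` as rank-one `𝒪_X`-modules
  (`Motives.HasRank _ 1`), the presented object `E`, the presentation `φ`, the design sequence short exact, `𝒯_X`
  finite locally free (smoothness input: the `𝓗om(𝒯, –)`-twist of the design sequence is then short exact by the
  tree's `shortExact_map_sheafHomFunctor_tangentSheaf`, not assumed), and the `T_W ≅ M₄(ℂ)` dictionary `κ ↦ (0 → 𝒯 → K
  κ → 𝒪_X → 0)`;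
* (ii) `KunnethInputs R n` — the CLASSICAL identifications, in HYPOTHESIS form (fields, no Literature fact, nothing
  asserted), each docstring naming the classical statement it stands for: `Ext^q(L, M) = H^q(X, M ⊗ L⁻¹)` for line
  bundles (Hartshorne III.6.3 ∕ 6.7); the Künneth formula for the coherent cohomology of `⊠`-products on `S⁴ = Π_f
  S_f` (Stacks 0BEC); on each factor the Leray decomposition for `π_ζ : S_f → C_ζ` with fibre class `ℓ_ζ`,
  Riemann–Roch on the elliptic curve (`dim H⁰(C, O(d·o)) = d`, basis `x^j y^k`) and Serre duality — together the INDEX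
  COUNT that makes `idxH0` ∕ `idxH2` bases (716 §THE MODEL); and «Yoneda product = cup product», read coordinatewise
  by 716 `coefProd` — fields `sec, unk, low, upp, low_comp, upp_comp` (the last under 716's own guard `UpperRowPure`,
  see (c6));
* (iii) `ObDictionary R KI h : Prop` — the `ob`-DICTIONARY (B4), stated ALONE: in the coordinates of (ii) on the
  diagonal blocks `Ext²(L, L) = H²(S⁴, 𝒪)`, the obstruction `ob_κ(L) = At'(L) ≫ c_κ(L)` of a constituent reads as
  716's `ob (constituent) κ`. It is a sentence IN the coordinates of (ii) — separated as a declaration, dependent as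
  mathematics (R14.7 (k2) disposition). PROVENANCE (director-hodge R14.10 ∕ R14.18, (c8-DOC); kill k0 FIRED): B4 has
  NO non-classical content beyond coordinate conventions — it is the conjunction of [a] the Atiyah class of a LINE
  BUNDLE is its first Chern class in `H¹(Ω¹)` (Atiyah 1957; Huybrechts, *Complex Geometry* (2005), Prop. 4.3.10 and
  §4.4 p. 200: `(i∕2π)·A(L) = c₁(L)`), [b] `obExt` IS `κ ∪ At'(L)` by construction (the Yoneda composite `At'(L) ≫
  c_κ(L)` of `TwoLevelObstructionExtension` ∕ `Literature…Modules.ExtensionContraction`), [c] the Künneth coordinates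
  = (ii), with `c₁` of a constituent given by its letters (716 `Constituent`: charges `c_f`, phases `ζ_f`), and [d]
  row 716's `Pad4FirstOrder.ob` (`Pad4FirstOrderModel.lean` :250–262) is BY DEFINITION the coordinate table of `Σ_f
  c_f · ξ̄_{ζ_f}^{(f)} ∧ κ(ξ_{ζ_f}^{(f)}) = (κ ∪ c₁ X)^{0,2}` in that basis (ingredients `kap`, `xiBar` only) — so no
  finite identity «`ob` = cup-product table» remains to prove (it would be `rfl`), and a coordinate-free form
  «`ob_κ(L) = κ ∪ c₁(L)`» would need module-level Hodge cup products the tree does not have. A separately NAMED kernel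
  hypothesis for step [a] (`AtiyahIsC1`) is deferred as a (T) item (R14.18), not typed here.

Then `KunnethLerayFrame.ofRealisation R KI hob` assembles the frame of (c6), and the corollaries
`H2_of_realisation_of_forall_obExt_eq_zero` ∕ `exists_obExt_ne_zero_of_realisation` are (c6)'s two theorems composed
with it. No inhabitant of (i)–(iii) for the actual anchor `S⁴ = (E_i × E_i)⁴` is constructed or claimed. No Literature
fact (`def … : Prop`) is declared or used; no instance, no notation; no edit of row 716; census-neutral. NOTHING HERE
SAYS THAT HC ∕ HC_CM ∕ HC_AV ∕ W₆ ∕ HC_Kum4Type HOLDS OR FAILS; `theoremLZeta_holds` stays a theorem of the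
first-order MODEL; (S3) ∕ (S5) status words do not move; nothing here is a statement about `stub_rung_pad4_seedAt`.
Research route conditional on HC_CM; not a corollary.
-/

noncomputable section
namespace Summit.Ventures.HSemireg.TwoLevelObstruction

open CategoryTheory CategoryTheory.Abelian CategoryTheory.Limits AlgebraicGeometry
open Literature.AlgebraicGeometry.HodgeTheory Literature.AlgebraicGeometry.Modules
  Literature.AlgebraicGeometry.Motives
open Summit.Ventures.HSemireg.Pad4FirstOrder

universe w u

variable {k : Type u} [CommRing k] (X : Over (Spec (CommRingCat.of k))) [HasExt.{w} X.left.Modules]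
  [HasFiniteBiproducts X.left.Modules]

/-! ## §1 (i) The geometric data: a line-bundle realisation of a model design -/

/-- **(i) A line-bundle realisation of the model design `D`** on the `S`-scheme `X`: rank-one `𝒪_X`-modules `N_i`,
`P_j` for the constituents, the presented object `E`, the presentation `0 → ⊕ P →φ ⊕ N →g E → 0` (short exact), `𝒯_X`
finite locally free, and for every direction `κ ∈ T_W ≅ M₄(ℂ)` (716 `kap`) an extension `0 → 𝒯 → K κ → 𝒪_X → 0` (a
class in `H¹(X, 𝒯)`).
GEOMETRY ONLY — no coordinates. [definition of this file] -/
structure LineBundleRealisation (D : Design) where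
  /-- the lower constituents `N_i` as `𝒪_X`-modules. -/
  N : Fin D.nN → X.left.Modules
  /-- the upper constituents `P_j`. -/
  P : Fin D.nP → X.left.Modules
  /-- each `N_i` is a line bundle (rank one). -/
  hasRank_N : ∀ i, HasRank (N i) 1
  /-- each `P_j` is a line bundle (rank one). -/
  hasRank_P : ∀ j, HasRank (P j) 1
  /-- the presented object `E`. -/
  E : X.left.Modules
  /-- the presentation `φ : ⊕ P → ⊕ N` (its entries `entry φ r j : P_j → N_r` are the sections `φ_{N_r P_j}`). -/
  φ : ⨁ P ⟶ ⨁ N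
  /-- the quotient map `⊕ N → E`. -/
  g : ⨁ N ⟶ E
  /-- `φ ≫ g = 0`. -/
  w : φ ≫ g = 0
  /-- the design sequence is short exact. -/
  hS : (ShortComplex.mk φ g w).ShortExact
  /-- `𝒯_X = (Ω¹_{X∕k})^∨` is finite locally free (e.g. `X → Spec k` smooth). -/
  h𝒯 : IsFiniteLocallyFree (tangentSheaf X)
  /-- the extension module `K κ` of the direction `κ`. -/
  K : Matrix (Fin 4) (Fin 4) ℂ → X.left.Modules
  /-- `𝒯 → K κ`. -/
  ι : ∀ κ, tangentSheaf X ⟶ K κ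
  /-- `K κ → 𝒪_X`. -/
  π : ∀ κ, K κ ⟶ unitModule X.left
  /-- `ι κ ≫ π κ = 0`. -/
  wκ : ∀ κ, ι κ ≫ π κ = 0
  /-- `0 → 𝒯 → K κ → 𝒪_X → 0` is short exact. -/
  hκ : ∀ κ, (ShortComplex.mk (ι κ) (π κ) (wκ κ)).ShortExact

namespace LineBundleRealisation

variable {X} {D : Design} (R : LineBundleRealisation X D)

omit [HasExt.{w} X.left.Modules] in
/-- The `𝓗om(𝒯, –)`-twist of the design sequence of a realisation IS short exact (a theorem, from `h𝒯`:
`shortExact_map_sheafHomFunctor_tangentSheaf`). -/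
theorem hTS : ((ShortComplex.mk R.φ R.g R.w).map (sheafHomFunctor (tangentSheaf X))).ShortExact :=
  shortExact_map_sheafHomFunctor_tangentSheaf R.hS R.h𝒯

end LineBundleRealisation

/-! ## §2 (ii) The classical identifications, hypothesis form -/

/-- **(ii) Künneth inputs of a realisation** in degree `n` — the CLASSICAL identifications between the `Ext`-groups of
the constituents and row 716's coordinate spaces, as HYPOTHESES (fields; nothing here is asserted or cited as a fact):
`Ext^q(L, M) = H^q(X, M ⊗ L⁻¹)` for line bundles; Künneth for `⊠`-products on `S⁴ = Π_f S_f`; per factor Leray for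
`S_f → C_ζ`, Riemann–Roch and Serre duality on the elliptic curve — the index count behind `idxH0` (sections) and
`idxH2` (degree-two classes); and «Yoneda product = cup product» read coordinatewise by `coefProd` as in 716
`lowerLHS` ∕ `upperLHS`.
[definition of this file] -/
structure KunnethInputs {D : Design} (R : LineBundleRealisation X D) (n : ℕ) where
  /-- Künneth–Leray coordinates of SECTIONS: an entry `P_j → N_r` (`∈ Hom(P_j, N_r) = H⁰(N_r − P_j)`) read on the
  indices
  `idxH0 (D.N r) (D.P j)` (Riemann–Roch monomials per factor). -/
  sec : ∀ (r : Fin D.nN) (j : Fin D.nP), (R.P j ⟶ R.N r) → (Fin 4 → ℕ × ℕ) → ℂ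
  /-- Künneth–Leray coordinates of UNKNOWNS: a class in `Extⁿ(N_i, P_j) = H²(P_j − N_i)` read on `idxH2 (D.P j) (D.N
  i)`. -/ unk : ∀ (i : Fin D.nN) (j : Fin D.nP), Ext.{w} (R.N i) (R.P j) n → (Fin 4 → ℕ) → (Fin 4 → ℕ × ℕ) → ℂ
  /-- Künneth–Leray coordinates of LOWER ROWS: `Extⁿ(N_i, N_r) = H²(N_r − N_i)` read on `idxH2 (D.N r) (D.N i)`,
  additively. -/ low : ∀ (i r : Fin D.nN), Ext.{w} (R.N i) (R.N r) n →+ ((Fin 4 → ℕ) × (Fin 4 → ℕ × ℕ) → ℂ)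
  /-- Künneth–Leray coordinates of UPPER ROWS: `Extⁿ(P_s, P_j) = H²(P_j − P_s)` read on `idxH2 (D.P j) (D.P s)`,
  additively. -/ upp : ∀ (s j : Fin D.nP), Ext.{w} (R.P s) (R.P j) n →+ ((Fin 4 → ℕ) × (Fin 4 → ℕ × ℕ) → ℂ)
  /-- «Yoneda product = cup product», lower side: the coordinates of `η ∘ φ_{rj}` on a kept index of `H²(N_r − N_i)`
  are the
  `coefProd`-bilinear expression of 716 `lowerLHS` (its `j`-summand) in the coordinates of `φ_{rj}` and `η`. -/
  low_comp : ∀ (i r : Fin D.nN) (j : Fin D.nP) (η : Ext.{w} (R.N i) (R.P j) n) (t : (Fin 4 → ℕ) × (Fin 4 → ℕ × ℕ)),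
    t ∈ idxH2 (D.N r) (D.N i) →
      low i r (η.comp (Ext.mk₀ (entry R.φ r j)) (add_zero n)) t =
        ∑ u ∈ idxH2 (D.P j) (D.N i), ∑ a ∈ idxH0 (D.N r) (D.P j),
          (if u.1 = t.1 then coefProd (rel (D.P j) (D.N i)) (rel (D.N r) (D.P j)) t.1 u.2 a t.2 else 0) *
            sec r j (entry R.φ r j) a * unk i j η u.1 u.2
  /-- «Yoneda product = cup product», upper side, under 716's guard `UpperRowPure j s`: the coordinates of `φ_{is} ∘
  η′` on a
  kept index of `H²(P_j − P_s)` are the `i`-summand of 716 `upperLHS`. -/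
  upp_comp : ∀ (j s : Fin D.nP), D.UpperRowPure j s → ∀ (i : Fin D.nN) (η : Ext.{w} (R.N i) (R.P j) n)
    (t : (Fin 4 → ℕ) × (Fin 4 → ℕ × ℕ)), t ∈ idxH2 (D.P j) (D.P s) →
      upp s j ((Ext.mk₀ (entry R.φ i s)).comp η (zero_add n)) t =
        ∑ u ∈ idxH2 (D.P j) (D.N i), ∑ a ∈ idxH0 (D.N i) (D.P s),
          (if u.1 = t.1 then coefProd (rel (D.P j) (D.N i)) (rel (D.N i) (D.P s)) t.1 u.2 a t.2 else 0) *
            sec i s (entry R.φ i s) a * unk i j η u.1 u.2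

namespace KunnethInputs

variable {X} {D : Design} {R : LineBundleRealisation X D} {n : ℕ} (KI : KunnethInputs X R n)

/-- The model sections read through the Künneth inputs: `φ r j a :=` the `a`-coordinate of `entry φ r j`. [definition
of this file] -/
def sections : D.Sections := fun r j a => KI.sec r j (entry R.φ r j) a

end KunnethInputs

/-! ## §3 (iii) The ONE new hypothesis: the `ob`-dictionary (B4) -/

/-- **(iii) The `ob`-dictionary (B4)** of a realisation with Künneth inputs, in degree `n` (`1 + 1 = n`): in the
coordinates of (ii) on the diagonal blocks `Ext²(L, L) = H²(S⁴, 𝒪)`, the obstruction `ob_κ(L) = At'(L) ≫ c_κ(L)` of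
each constituent reads as row 716's demand `ob (constituent) κ`, for every direction `κ`. Stated alone; a sentence in
(ii)'s coordinates (separated as a declaration, dependent as mathematics). PROVENANCE ((c8-DOC), R14.10 ∕ R14.18, k0
fired): [a] `At'(L) = c₁(L)` in `H¹(Ω¹)` for a line bundle (Atiyah 1957; Huybrechts 2005 Prop. 4.3.10, §4.4 p. 200
`(i∕2π)·A(L) = c₁(L)`) + [b] `obExt = κ ∪ At'` by construction + [c] Künneth coordinates (ii), `c₁` = the
constituent's letters + [d] 716 `Pad4FirstOrder.ob` (:250–262) IS by definition the coordinate table of `(κ ∪ c₁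
X)^{0,2} = Σ_f c_f · ξ̄_{ζ_f}^{(f)} ∧ κ(ξ_{ζ_f}^{(f)})` — classical modulo coordinate conventions; no
finite identity left to prove. [definition of this file] -/
structure ObDictionary {D : Design} (R : LineBundleRealisation X D) {n : ℕ} (KI : KunnethInputs X R n) (h : 1 + 1 = n) :
    Prop where
  /-- lower constituents: `ob_κ(N_i)` reads as `ob (D.N i) κ` on `idxH2 (D.N i) (D.N i)`. -/
  low_ob : ∀ (κ : Matrix (Fin 4) (Fin 4) ℂ) (i : Fin D.nN) (t : (Fin 4 → ℕ) × (Fin 4 → ℕ × ℕ)),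
    t ∈ idxH2 (D.N i) (D.N i) → KI.low i i (obExt (R.hκ κ) h (R.N i)) t = ob (D.N i) κ t.1 t.2
  /-- upper constituents: `ob_κ(P_j)` reads as `ob (D.P j) κ` on `idxH2 (D.P j) (D.P j)`. -/
  upp_ob : ∀ (κ : Matrix (Fin 4) (Fin 4) ℂ) (j : Fin D.nP) (t : (Fin 4 → ℕ) × (Fin 4 → ℕ × ℕ)),
    t ∈ idxH2 (D.P j) (D.P j) → KI.upp j j (obExt (R.hκ κ) h (R.P j)) t = ob (D.P j) κ t.1 t.2

/-! ## §4 Assembly: the frame of (c6), and the two corollaries -/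

namespace KunnethLerayFrame

variable {X} {D : Design} {n : ℕ} {h : 1 + 1 = n}

/-- **The Künneth–Leray frame of a realisation** from (i) the geometry, (ii) the classical identifications and (iii) the
`ob`-dictionary: B3 = (ii), B4 = (iii), the 𝒯-twist short exactness a theorem. [construction of this file] -/
def ofRealisation (R : LineBundleRealisation X D) (KI : KunnethInputs X R n) (hob : ObDictionary X R KI h) :
    KunnethLerayFrame X D h where
  N := R.N
  P := R.P
  E := R.E
  φ := R.φ
  g := R.g
  w := R.w
  hS := R.hS
  hTS := R.hTS
  K := R.K
  ι := R.ι
  π := R.π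
  wκ := R.wκ
  hκ := R.hκ
  sec := KI.sec
  unk := KI.unk
  low := KI.low
  upp := KI.upp
  low_comp := KI.low_comp
  upp_comp := KI.upp_comp
  low_ob := hob.low_ob
  upp_ob := hob.upp_ob

/-- Its model sections are those of the Künneth inputs. -/
theorem ofRealisation_sections (R : LineBundleRealisation X D) (KI : KunnethInputs X R n)
    (hob : ObDictionary X R KI h) : (ofRealisation R KI hob).sections = KI.sections := rfl

end KunnethLerayFrame

section Corollaries

variable {X} {D : Design} {n : ℕ} {h : 1 + 1 = n}

/-- **THE BRIDGE from (i) + (ii) + (iii)**: for a line-bundle realisation with Künneth inputs and the `ob`-dictionary,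
if
`ob_κ(E) = 0` for every direction `κ` then row 716's `H2` holds at the sections of the realisation. -/
theorem H2_of_realisation_of_forall_obExt_eq_zero (R : LineBundleRealisation X D) (KI : KunnethInputs X R n)
    (hob : ObDictionary X R KI h) (h0 : ∀ κ : Matrix (Fin 4) (Fin 4) ℂ, obExt (R.hκ κ) h R.E = 0) :
    D.H2 KI.sections :=
  (KunnethLerayFrame.ofRealisation R KI hob).H2_of_forall_obExt_eq_zero h0

/-- **THE GEOMETRIC NO-GO from (i) + (ii) + (iii)** and `theoremLZeta_holds`: for a class-y design realised by line
bundles with a minimal presentation, `(H1)` forces some direction `κ ∈ T_W` with `ob_κ(E) ≠ 0`. Trust base made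
explicit: the MODEL theorem,
the classical identifications (ii) in hypothesis form, and the ONE new hypothesis (iii). -/
theorem exists_obExt_ne_zero_of_realisation (R : LineBundleRealisation X D) (KI : KunnethInputs X R n)
    (hob : ObDictionary X R KI h) (hY : D.InClassY) (hmin : D.Minimal KI.sections) (h1 : D.H1) :
    ∃ κ : Matrix (Fin 4) (Fin 4) ℂ, obExt (R.hκ κ) h R.E ≠ 0 :=
  (KunnethLerayFrame.ofRealisation R KI hob).exists_obExt_ne_zero hY hmin h1

end Corollaries

end Summit.Ventures.HSemireg.TwoLevelObstruction

end
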